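import Summits.CriticalPhenomena.PercolationContinuityZ3.Theorems.Transplant.CayleyZ2RotC4Inputs
import Summits.CriticalPhenomena.PercolationContinuityZ3.Theorems.Transplant.SkelPhiPsiSteps
import Summits.CriticalPhenomena.PercolationContinuityZ3.Theorems.Transplant.SkelPhiCylBallFrom
import HarnessLib

/-!
# The rotor square lattice `X` as the POSITIVE CONTROL of the quasi-step rung (N3-b): `X` carries frames, a 1-Lipschitz chart, connected cylinders and
# QUASI-STEPS OF LENGTH 3 WITH EXACT FOOTPRINT in the lane's own LEVEL-1 currency `Skelφ.PsiSteps` — everything a `PlanarSkeletonFrmQuasi` would ask — and NO single-edge steps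

builds on p205010 (kernel theorem, internal audit signed; external expert review pending) — nothing in this file uses p205010 (pure graph combinatorics on `Z2Rot.graph`).  Lane
`prim-bschramm`, seat `prim-bschramm-p5` gen 27 (refuter seat: the positive control named in p3 g28's N3B-RUNG.md §5 R3 — «X HAS quasi-steps (M = 3) and NO single-edge chart» — made
kernel on both legs).  Helper file (`--supports stmt-CriticalPhenomena-4575 --as helper`); no node / statement / `@[conjecture]`; the quasi-step CARRIER of N3B-RUNG §3 is NOT declared here
(planners' ruling R2) and nothing about `θ(p_c)` of `X` is claimed.
* §1 `Z2Rot.rotor_psiLip : Skelφ.Lip X Prod.fst`, `Z2Rot.rotor_psiFrames : Skelφ.Frames X Prod.fst Z2Rot.types` (translations; four types);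
* §2 `Z2Rot.exists_turnWalk`: the turn walk `(v,k) ⇝ (v,k′)` of length ≤ 2 at constant position;
* §3 **`Z2Rot.rotor_psiSteps : Skelφ.PsiSteps X Prod.fst 3`** — at every vertex, every axis and sign: turn (≤ 2 edges, position fixed) then ONE move: a walk of length ≤ 3 to a vertex one
  chart unit away whose track stays in the hull of the endpoints (indeed AT the start until the last edge: EXACT footprint, N3B-RUNG §7's (ι_M′) as well);
* §4 `Z2Rot.rotor_cylConnFrom : Skelφ.CylConnFrom X Prod.fst Z2Rot.types 0` — every box cylinder `{(w,m) : ‖w‖_∞ ≤ ℓ}` is connected (turn–move–turn inside the box);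
* §5 `Z2Rot.not_steps : ∀ φ, ¬ Skelφ.Steps X φ` (p495173 at `N = 1`) and the summary `Z2Rot.quasiInputs`.
So `X` inhabits 'frames + Lip + PsiSteps 3 + (κ′) from width 0' while refuting (ι): the day a quasi-step node lands, `X` is a one-line customer; until then it certifies that the rung is not empty.
[cite: BenjaminiSchramm1996, Conj. 4; §2] [cite: KozmaNitzan2024, §4 p. 16 (Lemma 8)] [this work]
-/

noncomputable section

namespace Summit.CriticalPhenomena.PercolationContinuityZ3.Theorems.Transplant

open Literature.Probability.Percolation Literature.Probability.LatticeModels SimpleGraph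
open scoped Classical

namespace Z2Rot

/-! ## §1 The position chart: 1-Lipschitz, framed by the translations over the four types -/

/-- The position chart of `X` is 1-Lipschitz along bonds. [folklore] -/
theorem rotor_psiLip : Skelφ.Lip graph (Prod.fst : Vtx → Site 2) := fun a b h i => by
  have := abs_fst_sub_le h i
  rw [abs_sub_comm, Nat.cast_one] at this
  exact this

/-- The position chart of `X` is framed by the translations `shiftIso` over `Z2Rot.types`. [folklore] -/
theorem rotor_psiFrames : Skelφ.Frames graph (Prod.fst : Vtx → Site 2) types := fun v =>
  ⟨((0 : Site 2), v.2), mem_types v.2, shiftIso v.1, by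
    show ((0 : Site 2) + v.1, v.2) = v
    rw [zero_add], fun w => by
    show w.1 + v.1 = w.1 + (v.1 - (0 : Site 2))
    rw [sub_zero]⟩

/-! ## §2 Turn walks at constant position -/

/-- Two headings differ by `0`, `1`, `2` or `−1`. [folklore] -/
theorem heading_cases (k k' : Fin 4) : k' = k ∨ k' = k + 1 ∨ k' = k + 1 + 1 ∨ k' = k - 1 := by
  revert k k'; decide

/-- **The turn walk**: `(v, k) ⇝ (v, k′)` along at most two turn edges, every vertex at position `v`. [folklore] -/
theorem exists_turnWalk (v : Site 2) (k k' : Fin 4) :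
    ∃ p : graph.Walk ((v, k) : Vtx) (v, k'), p.length ≤ 2 ∧ ∀ u ∈ p.support, u.1 = v := by
  rcases heading_cases k k' with rfl | rfl | rfl | rfl
  · exact ⟨Walk.nil, by simp, fun u hu => by rw [Walk.support_nil, List.mem_singleton] at hu; rw [hu]⟩
  · refine ⟨Walk.cons (adj_turn v k) Walk.nil, by simp, fun u hu => ?_⟩
    rw [Walk.support_cons, Walk.support_nil, List.mem_cons, List.mem_singleton] at hu
    rcases hu with rfl | rfl <;> rfl
  · refine ⟨Walk.cons (adj_turn v k) (Walk.cons (adj_turn v (k + 1)) Walk.nil), by simp, fun u hu => ?_⟩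
    rw [Walk.support_cons, Walk.support_cons, Walk.support_nil, List.mem_cons, List.mem_cons, List.mem_singleton] at hu
    rcases hu with rfl | rfl | rfl <;> rfl
  · refine ⟨Walk.cons (adj_turn' v k) Walk.nil, by simp, fun u hu => ?_⟩
    rw [Walk.support_cons, Walk.support_nil, List.mem_cons, List.mem_singleton] at hu
    rcases hu with rfl | rfl <;> rfl

/-! ## §3 Quasi-steps of length 3 (exact footprint) -/

/-- Every signed unit coordinate vector is a heading vector. [folklore] -/
theorem exists_dir_eq_single (i : Fin 2) (σ : ℤˣ) : ∃ k : Fin 4, dir k = Pi.single i (σ : ℤ) := by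
  rcases Int.units_eq_one_or σ with rfl | rfl <;> fin_cases i
  · exact ⟨0, by ext t; fin_cases t <;> simp [dir]⟩
  · exact ⟨1, by ext t; fin_cases t <;> simp [dir]⟩
  · exact ⟨2, by ext t; fin_cases t <;> simp [dir]⟩
  · exact ⟨3, by ext t; fin_cases t <;> simp [dir]⟩

/-- **`X` HAS QUASI-STEPS OF LENGTH 3 — `Skelφ.PsiSteps X Prod.fst 3`**: turn to the heading of the wanted axis direction (≤ 2 edges, position fixed), then move once; the track sits at
the start position until the last edge, so it lies in the hull of the endpoints (exact footprint). [this work] -/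
theorem rotor_psiSteps : Skelφ.PsiSteps graph (Prod.fst : Vtx → Site 2) 3 := by
  rintro ⟨v, k⟩ i σ
  obtain ⟨k', hk'⟩ := exists_dir_eq_single i σ
  obtain ⟨p, hp, hs⟩ := exists_turnWalk v k k'
  refine ⟨(v + dir k', k'), by rw [hk'], p.append (Walk.cons (adj_move v k') Walk.nil), ?_, fun u hu => ?_⟩
  · rw [Walk.length_append, Walk.length_cons, Walk.length_nil]; omega
  · rw [Walk.mem_support_append_iff] at hu
    rcases hu with hu | hu
    · rw [hs u hu]
      exact Skelφ.inHull_left _ _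
    · rw [Walk.support_cons, Walk.support_nil, List.mem_cons, List.mem_singleton] at hu
      rcases hu with rfl | rfl
      · show Skelφ.InHull v (v + dir k') v
        exact Skelφ.inHull_left _ _
      · exact Skelφ.inHull_right _ _

/-! ## §4 Box cylinders of `X` are connected (turn–move–turn inside the box) -/

/-- The box cylinder of half-width `ℓ` in `X`. [folklore] -/
abbrev boxCyl (ℓ : ℕ) : Set Vtx := {w | w.1 ∈ box 2 ℓ}

/-- Membership, two coordinates. [folklore] -/
theorem mem_boxCyl {ℓ : ℕ} {v : Site 2} {k : Fin 4} :
    ((v, k) : Vtx) ∈ boxCyl ℓ ↔ (-(ℓ : ℤ) ≤ v 0 ∧ v 0 ≤ ℓ) ∧ (-(ℓ : ℤ) ≤ v 1 ∧ v 1 ≤ ℓ) := by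
  rw [Set.mem_setOf_eq, mem_box]
  exact ⟨fun h => ⟨h 0, h 1⟩, fun h i => by fin_cases i <;> [exact h.1; exact h.2]⟩

/-- One induced step. [folklore] -/
theorem boxCylAdj {ℓ : ℕ} {a b : Vtx} (ha : a ∈ boxCyl ℓ) (hb : b ∈ boxCyl ℓ) (h : graph.Adj a b) : (graph.induce (boxCyl ℓ)).Adj ⟨a, ha⟩ ⟨b, hb⟩ := h

/-- Turning inside the box cylinder: `(v,k)` is joined to `(v,k')` for all headings (membership depends on the position only). [folklore] -/
theorem boxCyl_reachable_turn {ℓ : ℕ} (v : Site 2) (k k' : Fin 4) (h : ((v, k) : Vtx) ∈ boxCyl ℓ) :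
    (graph.induce (boxCyl ℓ)).Reachable ⟨(v, k), h⟩ ⟨(v, k'), h⟩ := by
  have hm : ∀ m : Fin 4, ((v, m) : Vtx) ∈ boxCyl ℓ := fun _ => h
  have st : ∀ m : Fin 4, (graph.induce (boxCyl ℓ)).Reachable ⟨(v, m), hm m⟩ ⟨(v, m + 1), hm (m + 1)⟩ :=
    fun m => (boxCylAdj (hm m) (hm (m + 1)) (adj_turn v m)).reachable
  have st' : ∀ m : Fin 4, (graph.induce (boxCyl ℓ)).Reachable ⟨(v, m), hm m⟩ ⟨(v, m - 1), hm (m - 1)⟩ :=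
    fun m => (boxCylAdj (hm m) (hm (m - 1)) (adj_turn' v m)).reachable
  rcases heading_cases k k' with rfl | rfl | rfl | rfl
  · rfl
  · exact st k
  · exact (st k).trans (st (k + 1))
  · exact st' k

/-- **Every vertex of the box cylinder is joined to `((0,0), 0)` inside it**: turn to heading `0`; reduce `|v₀|` by moves at heading `0`, and `|v₁|` by turn–move–turn through
heading `1`, each inside the box. [folklore] -/
theorem boxCyl_reachable_zero {ℓ : ℕ} (w : Vtx) (hw : w ∈ boxCyl ℓ) :
    (graph.induce (boxCyl ℓ)).Reachable ⟨w, hw⟩ ⟨((0 : Site 2), 0), by rw [mem_boxCyl]; simp⟩ := by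
  obtain ⟨v, k⟩ := w
  refine (boxCyl_reachable_turn v k 0 hw).trans ?_
  have hv0 : ((v, (0 : Fin 4)) : Vtx) ∈ boxCyl ℓ := hw
  suffices H : ∀ n : ℕ, ∀ (v : Site 2) (hv : ((v, (0 : Fin 4)) : Vtx) ∈ boxCyl ℓ), (v 0).natAbs + (v 1).natAbs = n →
      (graph.induce (boxCyl ℓ)).Reachable ⟨(v, 0), hv⟩ ⟨((0 : Site 2), 0), by rw [mem_boxCyl]; simp⟩ from H _ v hv0 rfl
  intro n
  induction n using Nat.strong_induction_on with
  | _ n ih =>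
    intro v hv hn
    have hb := mem_boxCyl.1 hv
    obtain ⟨⟨c00, c01⟩, ⟨c10, c11⟩, ⟨c20, c21⟩, ⟨c30, c31⟩⟩ := coords_move v
    by_cases h00 : v 0 = 0 ∧ v 1 = 0
    · have : v = 0 := by funext j; fin_cases j <;> simp [h00.1, h00.2]
      subst this; rfl
    by_cases hA : v 0 < 0
    · have hm : ((v + dir 0, (0 : Fin 4)) : Vtx) ∈ boxCyl ℓ := by rw [mem_boxCyl, c00, c01]; omega
      exact (boxCylAdj hv hm (adj_move v 0)).reachable.trans (ih _ (by rw [← hn, c00, c01]; omega) _ hm rfl)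
    by_cases hB : 0 < v 0
    · have hm : ((v - dir 0, (0 : Fin 4)) : Vtx) ∈ boxCyl ℓ := by rw [mem_boxCyl, c10, c11]; omega
      exact (boxCylAdj hv hm (adj_move' v 0)).reachable.trans (ih _ (by rw [← hn, c10, c11]; omega) _ hm rfl)
    by_cases hC : v 1 < 0
    · -- turn to heading 1, move `+e₁`, turn back
      have h1 : ((v, (1 : Fin 4)) : Vtx) ∈ boxCyl ℓ := hv
      have hm1 : ((v + dir 1, (1 : Fin 4)) : Vtx) ∈ boxCyl ℓ := by rw [mem_boxCyl, c20, c21]; omega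
      have hm : ((v + dir 1, (0 : Fin 4)) : Vtx) ∈ boxCyl ℓ := hm1
      exact (((boxCyl_reachable_turn v 0 1 hv).trans (boxCylAdj h1 hm1 (adj_move v 1)).reachable).trans
        (boxCyl_reachable_turn (v + dir 1) 1 0 hm1)).trans (ih _ (by rw [← hn, c20, c21]; omega) _ hm rfl)
    · have hD : 0 < v 1 := by omega
      have h1 : ((v, (1 : Fin 4)) : Vtx) ∈ boxCyl ℓ := hv
      have hm1 : ((v - dir 1, (1 : Fin 4)) : Vtx) ∈ boxCyl ℓ := by rw [mem_boxCyl, c30, c31]; omega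
      have hm : ((v - dir 1, (0 : Fin 4)) : Vtx) ∈ boxCyl ℓ := hm1
      exact (((boxCyl_reachable_turn v 0 1 hv).trans (boxCylAdj h1 hm1 (adj_move' v 1)).reachable).trans
        (boxCyl_reachable_turn (v - dir 1) 1 0 hm1)).trans (ih _ (by rw [← hn, c30, c31]; omega) _ hm rfl)

/-- The box cylinders of `X` are connected. [folklore] -/
theorem boxCyl_connected (ℓ : ℕ) : (graph.induce (boxCyl ℓ)).Connected :=
  haveI : Nonempty (boxCyl ℓ) := ⟨⟨((0 : Site 2), 0), by rw [mem_boxCyl]; simp⟩⟩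
  Connected.mk fun a b => (boxCyl_reachable_zero a.1 a.2).trans (boxCyl_reachable_zero b.1 b.2).symm

/-- **(κ′) for `X` from width `0`**: `Skelφ.CylConnFrom X Prod.fst Z2Rot.types 0`. [this work] -/
theorem rotor_cylConnFrom : Skelφ.CylConnFrom graph (Prod.fst : Vtx → Site 2) types 0 := by
  intro t ht ℓ _
  have h0 : t.1 = 0 := Z2RotSide.fst_eq_zero_of_mem_types ht
  have hS : {w : Vtx | w.1 - t.1 ∈ box 2 ℓ} = boxCyl ℓ := by
    ext w; simp only [Set.mem_setOf_eq, h0, sub_zero]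
  rw [hS]
  exact boxCyl_connected ℓ

/-! ## §5 No single-edge steps for ANY chart, and the summary -/

/-- **`X` has NO single-edge unit steps for ANY chart** (p495173 at `N = 1`). [this work] -/
theorem not_steps (φ : Vtx → Site 2) : ¬ Skelφ.Steps graph φ := fun h =>
  no_singleEdgeStep_chart 1 one_ne_zero φ fun v i σ => by
    obtain ⟨v', hv', hφ⟩ := h v i σ
    exact ⟨v', hv', by rw [hφ, one_mul]⟩

/-- **SUMMARY — THE POSITIVE CONTROL OF THE QUASI-STEP RUNG**: the rotor lattice carries frames over four types, a 1-Lipschitz chart, quasi-steps of length `3`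
(`Skelφ.PsiSteps`), cylinders connected from width `0`, `p_c < 1` — and no single-edge steps for any chart. [this work] -/
theorem quasiInputs :
    Skelφ.Frames graph (Prod.fst : Vtx → Site 2) types ∧ Skelφ.Lip graph (Prod.fst : Vtx → Site 2) ∧ Skelφ.PsiSteps graph (Prod.fst : Vtx → Site 2) 3 ∧
      Skelφ.CylConnFrom graph (Prod.fst : Vtx → Site 2) types 0 ∧ (∀ v : Vtx, criticalProb graph v < 1) ∧ ∀ φ : Vtx → Site 2, ¬ Skelφ.Steps graph φ :=
  ⟨rotor_psiFrames, rotor_psiLip, rotor_psiSteps, rotor_cylConnFrom, rotor_criticalProb_lt_one, not_steps⟩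

end Z2Rot

end Summit.CriticalPhenomena.PercolationContinuityZ3.Theorems.Transplant

end
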